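import Mathlib
import Summits.ResolutionOfSingularities.ResolutionOfSingularities.Theorems.WeightedInvariantGlobalizeLocalDropCylinder
import Summits.ResolutionOfSingularities.ResolutionOfSingularities.Theorems.WeightedInvariantLocalWeightedDropSurfaceGermsWon

/-!
# `WeightedInvariant.LocalWeightedDrop`, residuals W4|₄ / T″|₄ (skeleton v31): COVERED START CLASS #3 — CYLINDERS OVER SURFACE GERMS
# are won in `k⟦x₀,…,x₃⟧`, every characteristic, tame or wild

Crux item stmt-ResolutionOfSingularities-8899 `LocalWeightedDrop` (route `ResolutionOfSingularities/WeightedInvariant`), engine skeleton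
v31 (res-L1-w43-lead-1, fb48e93459d3708f), residual stubs `stub_wildWideApexFourStartsWon` (W4|₄) and `stub_tameWideApexFourStartsWon`
(T″|₄).  [OURS · L1 W4.3, chain w43, res-L1-w43-stub-3 (gen 4) = second hand on plan-1's DEALS gen 9 #26 «N = 4 TAME census + first cut»
(census owner res-L1-w43-stub-1); BOOKKEEPING over two tree theorems: the N = 3 layer `surfaceGermsWon` (`…SurfaceGermsWon`, stub worker 4
after lead-1's S3πM p510457 / S3ρ p520169) and the cylinder transport `wonBy_rename_succAbove` (`…GlobalizeLocalDropCylinder`: game values do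
not increase along cylinders).  Nothing here is a statement of H. Hironaka's manuscript; the game is the programme's own; AI-written,
gate-accepted means sorry-free with standard axioms, not refereed.  Definition-free.]

* `isSingular_of_rename_succAbove` — a cylinder `rename (Fin.succAbove j) g` is a singular germ only if `g` is;
* **`won_cylinder_of_surfaceGerm`** — `CobordantGame.Won k 4 (rename (Fin.succAboveEmb j) g)` for every singular `g ∈ k⟦x₀,x₁,x₂⟧`, every
  slot `j : Fin 4`, every algebraically closed `k` of characteristic `p` (a cylinder over a surface germ whose tangent cone has a line of
  vertices is a WIDE-APEX start, of either kind);
* **`won_four_of_eq_cylinder`** — every singular `f ∈ k⟦x₀,…,x₃⟧` that IS a cylinder (`f = rename (Fin.succAboveEmb j) g`) is won;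
* **`wildWideApexFourStartsWon_of_cylinder`**, **`tameWideApexFourStartsWon_of_cylinder`** — the two v31 `N = 4` residual stubs (binder
  shapes VERBATIM) under the extra hypothesis «`f` is a cylinder»: COVERED START CLASS #3 of the N = 4 census; none of the W4 / T″ cone
  hypotheses is used.
-/

set_option linter.dupNamespace false -- mandated namespace of this single-conjunct summit
set_option autoImplicit false

namespace Summit.ResolutionOfSingularities.ResolutionOfSingularities.Theorems

namespace TameN4

open Literature.AlgebraicGeometry.Resolution
open Literature.AlgebraicGeometry.Resolution.CobordantGame

variable {k : Type} [Field k]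

/-- A cylinder is a singular germ only if its base is. -/
theorem isSingular_of_rename_succAbove {n : ℕ} (j : Fin (n + 2)) {g : MvPowerSeries (Fin (n + 1)) k}
    (hf : IsSingular k (MvPowerSeries.rename (Fin.succAboveEmb j) g)) : IsSingular k g := by
  refine ⟨fun h0 => hf.1 ?_, singular_of_singular_rename (Fin.succAboveEmb j) hf.2⟩
  rw [h0, map_zero]

/-- **CYLINDERS OVER SURFACE GERMS ARE WON IN FOUR VARIABLES** (every characteristic, tame or wild): for every singular
`g ∈ k⟦x₀,x₁,x₂⟧` and every slot `j`, `CobordantGame.Won k 4 (rename (Fin.succAboveEmb j) g)` — the N = 3 layer `surfaceGermsWon`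
transported along the cylinder by `wonBy_rename_succAbove`. [OURS · L1 W4.3] -/
theorem won_cylinder_of_surfaceGerm (p : ℕ) (hp : p.Prime) (k : Type) [Field k] [CharP k p] [IsAlgClosed k] (j : Fin 4)
    (g : MvPowerSeries (Fin 3) k) (hg : IsSingular k g) : Won k 4 (MvPowerSeries.rename (Fin.succAboveEmb j) g) := by
  obtain ⟨α, hα⟩ := (surfaceGermsWon p hp k g hg).exists_wonBy
  exact (wonBy_rename_succAbove j hα).won

/-- Every singular four-variable germ that IS a cylinder over a surface germ is won. -/
theorem won_four_of_eq_cylinder (p : ℕ) (hp : p.Prime) (k : Type) [Field k] [CharP k p] [IsAlgClosed k]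
    (f : MvPowerSeries (Fin 4) k) (hf : IsSingular k f) (j : Fin 4) (g : MvPowerSeries (Fin 3) k)
    (hfg : f = MvPowerSeries.rename (Fin.succAboveEmb j) g) : Won k 4 f := by
  subst hfg
  exact won_cylinder_of_surfaceGerm p hp k j g (isSingular_of_rename_succAbove j hf)

/-- **COVERED START CLASS #3, WILD SIDE**: `stub_wildWideApexFourStartsWon` (skeleton v31, binder shape VERBATIM) holds for the starts
that are CYLINDERS over a surface germ — none of the W4 hypotheses is used. [OURS · L1 W4.3] -/
theorem wildWideApexFourStartsWon_of_cylinder : ∀ (p : ℕ), p.Prime → ∀ (k : Type) [Field k] [CharP k p] [IsAlgClosed k],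
      (∀ m : ℕ, m < 4 → ∀ g : MvPowerSeries (Fin m) k,
        CobordantGame.IsSingular k g → CobordantGame.Won k m g) →
      ∀ (f : MvPowerSeries (Fin 4) k), CobordantGame.IsSingular k f →
      (∀ g : MvPowerSeries (Fin 4) k, CobordantGame.IsSingular k g → g.order < f.order →
        CobordantGame.Won k 4 g) →
      ∀ (d : ℕ), f.order = d → p ∣ d →
      (∃ ℓ : Fin 4 → k, ∀ i j : Fin 4,
        MvPowerSeries.coeff (Finsupp.single i 1 + Finsupp.single j 1) f =
          MvPowerSeries.coeff (Finsupp.single i 1 + Finsupp.single j 1)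
            ((∑ l, MvPowerSeries.C (ℓ l) * MvPowerSeries.X l) ^ 2)) →
      (2 < d → ∃ c₁ c₂ : Fin 4 → k, (∀ α β : k, α • c₁ + β • c₂ = 0 → α = 0 ∧ β = 0) ∧
        (∀ v : Fin 4 → k, CobordantChart.initEval (fun _ : Fin 4 => 1) (v + c₁) d f =
          CobordantChart.initEval (fun _ : Fin 4 => 1) v d f) ∧
        (∀ v : Fin 4 → k, CobordantChart.initEval (fun _ : Fin 4 => 1) (v + c₂) d f =
          CobordantChart.initEval (fun _ : Fin 4 => 1) v d f)) →
      (∃ (j : Fin 4) (g : MvPowerSeries (Fin 3) k), f = MvPowerSeries.rename (Fin.succAboveEmb j) g) →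
      CobordantGame.Won k 4 f := by
  intro p hp k _ _ _ _ f hf _ _ _ _ _ _ hcyl
  obtain ⟨j, g, hfg⟩ := hcyl
  exact won_four_of_eq_cylinder p hp k f hf j g hfg

/-- **COVERED START CLASS #3, TAME SIDE**: `stub_tameWideApexFourStartsWon` (skeleton v31, binder shape VERBATIM) holds for the starts
that are CYLINDERS over a surface germ — none of the T″ hypotheses is used. [OURS · L1 W4.3] -/
theorem tameWideApexFourStartsWon_of_cylinder : ∀ (p : ℕ), p.Prime → ∀ (k : Type) [Field k] [CharP k p] [IsAlgClosed k],
    (∀ m : ℕ, m < 4 → ∀ g : MvPowerSeries (Fin m) k,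
      CobordantGame.IsSingular k g → CobordantGame.Won k m g) →
    ∀ (f : MvPowerSeries (Fin 4) k), CobordantGame.IsSingular k f →
    (∀ g : MvPowerSeries (Fin 4) k, CobordantGame.IsSingular k g → g.order < f.order →
      CobordantGame.Won k 4 g) →
    ∀ (d : ℕ), f.order = d → ¬ p ∣ d →
    (∃ ℓ : Fin 4 → k, ∀ i j : Fin 4,
      MvPowerSeries.coeff (Finsupp.single i 1 + Finsupp.single j 1) f =
        MvPowerSeries.coeff (Finsupp.single i 1 + Finsupp.single j 1)
          ((∑ l, MvPowerSeries.C (ℓ l) * MvPowerSeries.X l) ^ 2)) →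
    (2 < d → ∃ c₁ c₂ : Fin 4 → k, (∀ α β : k, α • c₁ + β • c₂ = 0 → α = 0 ∧ β = 0) ∧
      (∀ v : Fin 4 → k, CobordantChart.initEval (fun _ : Fin 4 => 1) (v + c₁) d f =
        CobordantChart.initEval (fun _ : Fin 4 => 1) v d f) ∧
      (∀ v : Fin 4 → k, CobordantChart.initEval (fun _ : Fin 4 => 1) (v + c₂) d f =
        CobordantChart.initEval (fun _ : Fin 4 => 1) v d f)) →
    (∃ (j : Fin 4) (g : MvPowerSeries (Fin 3) k), f = MvPowerSeries.rename (Fin.succAboveEmb j) g) →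
    CobordantGame.Won k 4 f := by
  intro p hp k _ _ _ _ f hf _ _ _ _ _ _ hcyl
  obtain ⟨j, g, hfg⟩ := hcyl
  exact won_four_of_eq_cylinder p hp k f hf j g hfg

end TameN4

end Summit.ResolutionOfSingularities.ResolutionOfSingularities.Theorems
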